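import Summits.Ventures.HodgeRepro.FaceReduce
import Summits.Ventures.HodgeRepro.GSetHodge

/-!
# Transfer of Pohlmann's product criterion along a type-compatible map

Blind re-derivation cell `pub-hodge-repro`, seat `typer` (gen 3).  Continues `FaceReduce.lean` /
`GSetHodge.lean`.

Lemma R (`FaceReduce.isHodgeSetProd_reducedSet`) produces Pohlmann sets of the product CM type
`(Φ k)_{k ∈ J}` on `⊔_k Hom(F, ℂ) = J × G`, i.e. Hodge classes of the reduced product `∏_k A_{Φ k}`.
When a class representative `A_{Φ k}` is itself isogenous to a power `E^r` of a CM abelian variety `E`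
of a subfield (the corner `Φ k` is INDUCED, `Primitive.lean`), the class lives already on
`∏ (smaller factors)`: the embeddings of the smaller CM algebra form a `G`-set `X` with a `G`-map
`ρ : J × G → X` that pulls the CM type `Ψ` of `X` back to `(Φ k)_k` (`IsTypeMap`), and Pohlmann's
criterion transfers along `ρ` on every subset on which `ρ` is injective:

* `IsTypeMap Φ Ψ ρ` — `ρ (k, τ x) = τ • ρ (k, x)` and `ρ (k, x) ∈ Ψ ↔ x ∈ Φ k`;
* **`IsTypeMap.isHodgeSetOn_image_iff`** — for `Δ ⊆ J × G` with `ρ` injective on `Δ`: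
  `IsHodgeSetOn c Ψ (Δ.image ρ) ↔ IsHodgeSetProd c Φ Δ`.

Nothing geometric is used; the statement is the identity `ρ (k, x) ∈ τ • Ψ ↔ τ⁻¹ x ∈ Φ k`, counted.
In the sealed degree-`6` census (§A.3) this is the passage from the corner product `B³ × E³` to
`Y = B × E` (`SexticWeil.lean`).
-/

open Finset
open scoped Pointwise

namespace HodgeRepro

variable {G : Type*} [Group G] [DecidableEq G] {J : Type*} {X : Type*} [DecidableEq X] [MulAction G X]

/-- A map `ρ : J × G → X` of the embeddings of the product CM algebra `F^J` to the `G`-set `X` is a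
*type map* for the product CM type `(Φ k)_k` and the CM type `Ψ` on `X` if it is `G`-equivariant
(`G` acting on the embedding coordinate) and pulls `Ψ` back to `(Φ k)_k`. -/
structure IsTypeMap (Φ : J → Finset G) (Ψ : Finset X) (ρ : J × G → X) : Prop where
  /-- `ρ` intertwines the Galois actions -/
  equivariant : ∀ (k : J) (τ x : G), ρ (k, τ * x) = τ • ρ (k, x)
  /-- `ρ` pulls the CM type of `X` back to the product type -/
  mem_iff : ∀ (k : J) (x : G), ρ (k, x) ∈ Ψ ↔ x ∈ Φ k

namespace IsTypeMap

variable {Φ : J → Finset G} {Ψ : Finset X} {ρ : J × G → X}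

omit [DecidableEq G] in
/-- A type map pulls every translate `τ • Ψ` back to the translate of the product type. -/
theorem mem_smul_iff (h : IsTypeMap Φ Ψ ρ) (k : J) (x τ : G) :
    ρ (k, x) ∈ τ • Ψ ↔ τ⁻¹ * x ∈ Φ k := by
  rw [← inv_smul_mem_iff, ← h.equivariant, h.mem_iff]

/-- A type map for `(Φ, Ψ)` is a type map for the conjugate types `(c • Φ, c • Ψ)`. -/
theorem conj (h : IsTypeMap Φ Ψ ρ) (c : G) : IsTypeMap (fun k => c • Φ k) (c • Ψ) ρ where
  equivariant := h.equivariant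
  mem_iff k x := by
    rw [h.mem_smul_iff, ← inv_smul_mem_iff, smul_eq_mul]

/-- Counting `τ • ρ(Δ) ∩ Ψ` is counting the elements `(k, y)` of `Δ` with `τ y ∈ Φ k`, when `ρ` is
injective on `Δ`. -/
theorem card_smul_image_inter (h : IsTypeMap Φ Ψ ρ) (Δ : Finset (J × G)) (hinj : Set.InjOn ρ Δ)
    (τ : G) : (τ • Δ.image ρ ∩ Ψ).card = (Δ.filter fun q => τ * q.2 ∈ Φ q.1).card := by
  rw [card_smul_inter_on, ← filter_mem_eq_inter, Finset.filter_image,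
    card_image_of_injOn (hinj.mono (Finset.coe_subset.2 (filter_subset _ _)))]
  refine congrArg Finset.card (filter_congr fun q _ => ?_)
  rw [show q = (q.1, q.2) from rfl, h.mem_smul_iff, inv_inv]

/-- **Transfer of Pohlmann's product criterion.**  For a type map `ρ` injective on `Δ ⊆ J × G`, the
image `ρ(Δ) ⊆ X` satisfies Pohlmann's condition for `Ψ` iff `Δ` satisfies the product criterion for
`(Φ k)_k`. -/
theorem isHodgeSetOn_image_iff (h : IsTypeMap Φ Ψ ρ) (c : G) (Δ : Finset (J × G))
    (hinj : Set.InjOn ρ Δ) : IsHodgeSetOn c Ψ (Δ.image ρ) ↔ IsHodgeSetProd c Φ Δ := by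
  unfold IsHodgeSetOn IsHodgeSetProd
  refine forall_congr' fun τ => ?_
  rw [h.card_smul_image_inter Δ hinj τ, (h.conj c).card_smul_image_inter Δ hinj τ]

end IsTypeMap

end HodgeRepro
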